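import Mathlib
import HarnessLib
import Summits.QuantumFields.YangMills.Theses.ScalingWindowSplit
import Summits.QuantumFields.YangMills.Theorems.MirrorModularBoostsHypercubicLimitCouplingResponseDefsC
import Summits.QuantumFields.YangMills.Theorems.ScalingWindowSplitExistenceLegFromLatticeR
import Summits.QuantumFields.YangMills.Theorems.SelfNormalisedMomentBounds.Negative.SelfNormalisedMomentBoundsFalseOfTwoRateWindowScheme
import Summits.QuantumFields.YangMills.Theorems.SelfNormalisedMomentBoundsR.Negative.FloorFalseOfSubsingleton
import Summits.QuantumFields.YangMills.Cruxes.SelfNormalisedMomentBoundsR.MaskedSectorObstruction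

/-!
# Disproof of `SelfNormalisedMomentBoundsR` (stmt-QuantumFields-18014) — findings of the crux disprover

Crux U_R = `ScalingWindowSplit.SelfNormalisedMomentBoundsR` (route `ScalingWindowSplit`, rev 8; line `Sketch` picked,
skeleton closed by the lead modulo ONE physics stub `stub_clusterBound`).  Disprover `cdisprove-stmt-QuantumFields-18014-g2`,
cycle 1 (2026-08-17).  Prose only in docstrings; everything below elaborates (the ONE `sorry` is the declared near-miss §E).

## Index of findings

* **§A VERDICT ON THE CRUX BY NAME: false modulo `H`, misstated (missing simplicity of `G`).**  U_R is typed for ALL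
  compact `G`.  Its `n ≤ 2` content already forces a UNIFORM TWO-POINT ENVELOPE (`twoPointEnvelope_of_uniformMomentBoundsPlanes`:
  one Schwartz order `s`, one constant `B`, eventually `|T⁰_k(v,w)| ≤ B(|v|ₛ+1)(|w|ₛ+1)·T⁰_k(u,θu)` for EVERY disjoint pair) —
  so ONE admissible datum with ONE disjoint pair decorrelating at a second rate kills it
  (`selfNormalisedMomentBoundsR_false_of_twoRatePairScheme`, hypothesis `TwoRatePairScheme` ⊇ the strategist's
  `TwoRateHonestWindowScheme`, `twoRatePairScheme_of_honest`), and so does a `k`-dependent envelope failure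
  (`selfNormalisedMomentBoundsR_false_of_envelopeFailure`).  LANDED verbatim as the negative lemma
  `Theorems/SelfNormalisedMomentBoundsR/Negative/SelfNormalisedMomentBoundsRFalseOfTwoRatePairScheme.lean`
  (`--negative-modulo TwoRatePairScheme`).  Intended inhabitant of `H` (physics-grade, strategist census §1 / idea
  `masked-abelian-sector`): the MASKED PRODUCT `G = U(1) × SU(2)`, `r = e^{iθ} ⊕ V`, with the `SU(2)` confinement scale put
  at `ε_k = 1/(2 log β_k) → 0` UNDER the abelian scale that carries floor and window: ratio `≍ β_k^{2-4d₀}(log β_k)⁸ → ∞`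
  (asymptotic freedom: the `SU(2)` plaquette two-point function at its own confinement scale is `≍ ξ⁻⁸` with a
  `β`-INDEPENDENT constant, `β²` above the abelian `β⁻² d⁻⁸` law that fixes `canon`).  WHY IT RESISTS an unconditional kill:
  inhabiting `H` needs (P1) Coulomb control of Wilson-`U(1)₄` AND (P2) scaling + gap + two-sided control of `SU(2)₄` at
  confinement — Clay-hard; and NO cheaper inhabitant exists (§A docstrings: abelian factors are Gaussian with one `d⁻⁸`
  shape at all scales, finite factors freeze BELOW the abelian `β⁻²` at the lattice scale, a simple factor inside its
  perturbative window is SOFTER than `d⁻⁸` towards the ultraviolet; the enhancement needs a non-abelian factor AT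
  confinement placed below the reference scale).  REPAIR `C′` = insert `IsCompactSimpleLieGroup G →` (strategist's
  `SelfNormalisedMomentBoundsRS`, glue `existenceLegFromLatticeRS`/`closesRS`; lead's transfer file
  `SelfNormalisedMomentBoundsRS.lean`: all 8 landed stubs transfer verbatim, only `stub_clusterBound` gains the hypothesis).

* **§B LOAD-BEARING HYPOTHESES (each dropped in turn).**
  - past support `tsupport u ⊆ {x⁰<0}`: load-bearing — dropping it gives back U = `SelfNormalisedMomentBounds`
    (stmt-18929, `withoutPastSupport_iff`), HELD by `SelfNormalisedMomentBounds_false_of_TwoRateWindowScheme`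
    (perverse window `u = τ₊₁w`); any honest two-rate datum is a fortiori a perverse one (`twoRateWindowScheme_of_honest`).
  - polynomial volumes: load-bearing — NEW mechanism, the TORUS SEAM (`withoutPolyVolume_false_of_seamEnvelopeFailure`):
    the smeared field lives on the periodic torus of side `(2L_k+1)a_k =: ℓ_k`, so two tests DISJOINT IN `ℝ⁴` hugging the
    faces `x⁰ ≈ +ℓ_k/2` and `x⁰ ≈ −ℓ_k/2` smear plaquettes that SHARE LINKS (`seam_adjacent`: torus distance `1`); their
    canon covariance is the coincident Wick-square singularity `≍ a_k⁻³ R³` (area of the seam patch in lattice units), tamed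
    ONLY by the Schwartz weights `‖x‖ˢ ≥ (ℓ_k/2)ˢ` on the amplitudes: `≍ ℓ_k^{3−2s} a_k⁻³`.  With `a_k⁻¹ ≤ (a_kL_k)^N` this is
    `≤ a_k^{(2s−3)/N − 3} → 0` iff `s > (3N+3)/2` — the Schwartz order MUST grow with the volume exponent `N` (the lead's
    `stub_assembly N ↦ s` does exactly this); WITHOUT polynomial volumes (`ℓ_k → ∞` slower than every power) no `s` works and
    the envelope fails along seam pairs — modulo the (Gaussian, physics-trivial but unbuilt) seam asymptotics of the super-weak
    `U(1)` scheme with sub-polynomial `L_k`.  Corollary for provers: no proof may produce a scheme-independent `s`.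
  - window `T⁰(u) ≤ M·T⁰(τ₋₁u)`: load-bearing (`withoutWindow_false_of_collapsingEnvelopeFailure`) — floor-only admits
    SLOWLY collapsing confining schemes (`m_phys ≤ (p/2d) log a_k⁻¹` keeps `a^p ≤ T⁰ ≍ a⁸e^{−2dm}`), on which a closer pair
    is enhanced by `e^{m(2d−δ)} → ∞`; inhabitant needs a non-abelian confining `G` (abelian: massless; finite: frozen, floor
    fails) — physics-grade, same status as 18929's `H`.
  - floor `a^p ≤ T⁰(u)`: NOT load-bearing for TRUTH as far as any model shows (`canon_bounds_of_subsingleton`: at the junk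
    group the floor-free hypotheses can hold and the conclusion HOLDS — `T⁰ ≡ 0 ⇒ c' = (√0)⁻¹ = 0 ⇒` all fields vanish;
    super-exponentially weak coupling `β_k ≫ a_k^{-q} ∀q`, which the floor excludes, is MORE Gaussian, not less); its job is
    `T⁰ > 0` (so `c'² = 1/T⁰`) and, route-side, `PolyRenorm`.  "possibly unnecessary" — information for the prover.
  - weak coupling `β_k → ∞`: possibly unnecessary too — fixed-`β` Coulomb `U(1)₄` is Gaussian-dominated in the infrared
    (expected true there), fixed-`β` confining theories collapse (`a_kξ → 0`) and are excluded by the window.  Not used by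
    any argument in this file.
  - group-blindness: THE misstatement (§A).

* **§C TARGETS — line `Sketch`.**  Skeleton `Lines/Sketch.lean` re-checked from the tree: rc 0, exactly ONE `sorry`
  (`stub_clusterBound`), `SelfNormalisedMomentBoundsR_of` kernel-composes the 8 landed stubs — joint sufficiency holds,
  nothing smuggled.  `stub_clusterBound` is typed ∀ compact `G` like the crux: its `n = 2` instance is the SITE-LEVEL
  `d⁻⁸` envelope `|Cov_k(P_q(x),P_{q'}(y))| ≤ C²·T⁰_k(u,θu)·(a_k d_torus(x,y))⁻⁸` (`clusterBound_two`), killed by the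
  masked product at lattice distance `d = ξ_{SU(2)}` (ratio `β_k²`) exactly as the crux — `clusterBound_false_of_siteTwoRate`
  (modulo the site-level two-rate hypothesis, inline).  After `C′` it needs `IsCompactSimpleLieGroup G →` (the lead's
  `stub_clusterBoundS`).  Sanity of the stub's SHAPE in the one computable regime (super-weak `U(1)`, Gaussian): LHS
  `= c'ⁿ(−½)ⁿ E∏:θ²: (1+O(n²/β))`, `|E∏:θ²:| ≤ 2ⁿ Σ_{σ fpf perm} ∏|G_{iσi}|/βⁿ ≤ 2ⁿβ⁻ⁿ ∏ᵢ(Σ_{j≠i}|G_{ij}|)` (row-sum bound),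
  `|G_{ij}| ≤ K d_{ij}⁻⁴`, `c'² β⁻² = a⁻⁸/κ_u`: this IS the stub's right side `Cⁿ Σ_f ∏(a d)⁻⁴ = Cⁿ a⁻⁴ⁿ ∏ᵢ σᵢ` with
  `C = 2K/√κ_u` — consistent, including dense clusters (`σᵢ ≍ log R`) and `n` up to the volume (`n² ≤ 256k¹⁶ ≪ β_k = k⁹⁶`).
  No cheap kill of the stub beyond the crux's own AT SHORT DISTANCE; but AT LONG DISTANCE the stub (and its `S` transfer) is
  MISSTATED for an asymptotically free `G`: in deep-UV admissible schemes the infrared running `(g_R/g_1)⁴ ≍ log ξ_phys,k → ∞`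
  along `R = ξ^{1−ε_k}` forbids a `k`-uniform `C` with the pure kernel (`ClusterBoundSlack`: corrected shape with a per-leg
  slack `(1 + a d)^η`, WEAKER than the stub — `clusterBoundSlack_of_clusterBound`; evidence note `stub_clusterBound.md`).

* **§D NATURAL STRENGTHENINGS refuted / flagged.**  (i) a scheme-independent Schwartz order `s`: false by the seam (§B).
  (ii) dropping pairwise disjointness: false trivially in every regime (`⟨Φ(v)²⟩_canon = c'² Var⁰(Φ(v)) ≍ a_k⁻⁴` — the
  smeared Wick square has divergent variance in `d = 4`).  (iii) `∀ k` vs eventually: harmless (`stub_eventually`, landed).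

* **§E NEAR-MISS.**  `twoRatePairScheme_inhabited` (`sorry`): the unconditional kill = inhabiting `H`; obstruction =
  (P1)+(P2) above; tried: every sector type of a compact Lie `G` at `β → ∞` (abelian / finite / simple-perturbative / seam /
  `k`-dependent pairs / large `n`) — none gives a second rate inside an admissible (PolyVolume!) datum without confinement
  physics.  So the by-name crux dies by RESTATEMENT (R1), not by a landed `¬`.
-/

noncomputable section

open scoped SchwartzMap BigOperators Topology
open MeasureTheory ProbabilityTheory Filter Topology
open Literature.MathematicalPhysics.AQFT Literature.MathematicalPhysics.QuantumLattice
open Literature.MathematicalPhysics.QuantumFieldTheory Literature.Probability.LatticeModels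
open Summit.QuantumFields.YangMills.Cruxes.HypercubicLimit.CouplingResponse
open Summit.QuantumFields.YangMills.Theorems.ScalingWindowSplit (trunc_rescale trunc_eq_covariance)
open Summit.QuantumFields.YangMills.Theorems.SelfNormalisedMomentBounds.Negative (trunc_smul TwoRateWindowScheme
  SelfNormalisedMomentBounds_false_of_TwoRateWindowScheme)
open Summit.QuantumFields.YangMills.Theorems.SelfNormalisedMomentBoundsR.Negative (trunc_eq_zero_of_subsingleton)
open Summit.QuantumFields.YangMills.Cruxes.SelfNormalisedMomentBoundsR.Strategist (TwoRateHonestWindowScheme)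

namespace Summit.QuantumFields.YangMills.Cruxes.SelfNormalisedMomentBoundsR.Disproof

variable {G : Type} [Group G] [TopologicalSpace G] [IsTopologicalGroup G] [CompactSpace G]
  [MeasurableSpace G] [BorelSpace G]

/-! ## §A  The crux by name: the two-point envelope and the negative lemma modulo `H`
(landed verbatim under `Theorems/SelfNormalisedMomentBoundsR/Negative/`; namespace here `…Cruxes….Disproof`) -/

/-- **Moment bounds of the self-normalised scheme force a UNIFORM two-point envelope** (the `n ≤ 2` content, factored
through the conclusion so that hypothesis-dropped variants of U_R can reuse it).  For ANY scheme `sch` and bump `u`: if the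
self-normalised scheme `canon` (`c'_k = 1/√T⁰_k(u,θu)`, torus-mean counterterm) obeys `UniformMomentBoundsPlanes r canon` and
`T⁰_k(u,θu) > 0` eventually, then there are ONE Schwartz order `s` and ONE constant `B ≥ 0` such that eventually in `k`, for
EVERY pair of real tests `v, w` with disjoint supports, `|T⁰_k(v, w)| ≤ B (|v|ₛ + 1)(|w|ₛ + 1) · T⁰_k(u, θu)`.  Proof:
`c'_k² = 1/T⁰_k(u,θu)` on the tail; the bounds at orders `1` and `2` (through the landed `uniformMomentBounds_of_planes`)
control `|𝔖₂^canon(λv ⊗ λ'w)|`, `|𝔖₁^canon(λv)|`, `|𝔖₁^canon(λ'w)|` uniformly in `k` and in the normalised pair, and the seam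
identity (`trunc_rescale`, `trunc_smul`) reads `𝔖₂^canon − 𝔖₁^canon 𝔖₁^canon = λλ' T⁰_k(v,w) / T⁰_k(u,θu)` with
`λ = (|v|ₛ+1)⁻¹`, `λ' = (|w|ₛ+1)⁻¹`. [folklore] -/
theorem twoPointEnvelope_of_uniformMomentBoundsPlanes
    (r : LatticeRep G) (sch : SpeciesScheme (YMSpecies G)) (u : 𝓢(EuclideanSpace ℝ (Fin 4), ℝ)) :
    let bare : SpeciesScheme (YMSpecies G) := { sch with c := fun _ _ => 1, m := fun _ _ => 0 }
    let T : 𝓢(EuclideanSpace ℝ (Fin 4), ℝ) → ℕ → ℝ := fun w k =>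
      latticeSchwinger r.ρ bare (fun s => s.F) k (1 + 1) (fun _ => r.curvature) ![w, thetaTest 4 w] -
        latticeSchwinger r.ρ bare (fun s => s.F) k 1 (fun _ => r.curvature) ![w] *
          latticeSchwinger r.ρ bare (fun s => s.F) k 1 (fun _ => r.curvature) ![thetaTest 4 w]
    let T₂ : 𝓢(EuclideanSpace ℝ (Fin 4), ℝ) → 𝓢(EuclideanSpace ℝ (Fin 4), ℝ) → ℕ → ℝ := fun v w k =>
      latticeSchwinger r.ρ bare (fun s => s.F) k (1 + 1) (fun _ => r.curvature) ![v, w] -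
        latticeSchwinger r.ρ bare (fun s => s.F) k 1 (fun _ => r.curvature) ![v] *
          latticeSchwinger r.ρ bare (fun s => s.F) k 1 (fun _ => r.curvature) ![w]
    let canon : SpeciesScheme (YMSpecies G) :=
      { sch with
        c := fun _ k => (Real.sqrt (T u k))⁻¹
        m := fun _ k => ∫ U, r.curvature.F (torusLift (sch.side k) U) ∂(wilsonMeasure r.ρ (sch.β k)) }
    UniformMomentBoundsPlanes r canon →
    (∀ᶠ k in Filter.atTop, 0 < T u k) →
    ∃ (s : ℕ) (B : ℝ), 0 ≤ B ∧ ∀ᶠ k in Filter.atTop, 0 < T u k ∧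
      ∀ v w : 𝓢(EuclideanSpace ℝ (Fin 4), ℝ), Disjoint (tsupport v) (tsupport w) →
        |T₂ v w k| ≤ B * (schwartzNorm s (ofRealTest v) + 1) * (schwartzNorm s (ofRealTest w) + 1) * T u k := by
  intro bare T T₂ canon hP hT
  obtain ⟨s, C₀, C₁, hb⟩ := uniformMomentBounds_of_planes G r canon hP
  -- the uniform constants
  set A₁ : ℝ := C₀ * C₁ ^ 1 * (Nat.factorial 1 : ℕ) with hA₁
  set A₂ : ℝ := C₀ * C₁ ^ (1 + 1) * (Nat.factorial (1 + 1) : ℕ) with hA₂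
  set B₀ : ℝ := |A₂| + A₁ * A₁ with hB₀
  -- `A₁ ≥ 0`: U_R at order one on the zero test function
  have hA₁0 : 0 ≤ A₁ := by
    have h := hb 1 ![0] (by
        intro i; fin_cases i
        simp [schwartzNorm]) (by intro i j hij; exact absurd (Subsingleton.elim i j) hij) 0
    exact (abs_nonneg _).trans h
  have hB₀0 : 0 ≤ B₀ := add_nonneg (abs_nonneg _) (mul_nonneg hA₁0 hA₁0)
  refine ⟨s, B₀, hB₀0, hT.mono fun k hTpos => ?_⟩
  refine ⟨hTpos, fun v w hdisj => ?_⟩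
  -- the normalised pair
  set N₁ : ℝ := schwartzNorm s (ofRealTest v) with hN₁
  set N₂ : ℝ := schwartzNorm s (ofRealTest w) with hN₂
  have hN₁0 : 0 ≤ N₁ := schwartzNorm_nonneg _ _
  have hN₂0 : 0 ≤ N₂ := schwartzNorm_nonneg _ _
  set l₁ : ℝ := (N₁ + 1)⁻¹ with hl₁
  set l₂ : ℝ := (N₂ + 1)⁻¹ with hl₂
  have hl₁0 : 0 < l₁ := inv_pos.2 (by linarith)
  have hl₂0 : 0 < l₂ := inv_pos.2 (by linarith)
  set v₁ : 𝓢(EuclideanSpace ℝ (Fin 4), ℝ) := l₁ • v with hv₁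
  set w₁ : 𝓢(EuclideanSpace ℝ (Fin 4), ℝ) := l₂ • w with hw₁
  have hn₁ : schwartzNorm s (ofRealTest v₁) ≤ 1 := by
    rw [hv₁, schwartzNorm_ofRealTest_smul, abs_of_pos hl₁0, ← hN₁, hl₁]
    rw [inv_mul_le_iff₀ (by linarith : (0 : ℝ) < N₁ + 1)]
    linarith
  have hn₂ : schwartzNorm s (ofRealTest w₁) ≤ 1 := by
    rw [hw₁, schwartzNorm_ofRealTest_smul, abs_of_pos hl₂0, ← hN₂, hl₂]
    rw [inv_mul_le_iff₀ (by linarith : (0 : ℝ) < N₂ + 1)]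
    linarith
  have hd₁₂ : Disjoint (tsupport (v₁ : EuclideanSpace ℝ (Fin 4) → ℝ))
      (tsupport (w₁ : EuclideanSpace ℝ (Fin 4) → ℝ)) :=
    hdisj.mono (tsupport_smul_subset_right (fun _ => l₁) _) (tsupport_smul_subset_right (fun _ => l₂) _)
  -- U_R at orders two and one
  have h2 := hb (1 + 1) ![v₁, w₁]
    (by
      intro i
      fin_cases i
      · simpa using hn₁
      · simpa using hn₂)
    (by
      intro i j hij
      fin_cases i <;> fin_cases j
      · exact absurd rfl hij
      · simpa using hd₁₂
      · simpa using hd₁₂.symm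
      · exact absurd rfl hij) k
  have h1 := hb 1 ![v₁] (by intro i; fin_cases i; simpa using hn₁)
    (by intro i j hij; exact absurd (Subsingleton.elim i j) hij) k
  have h1' := hb 1 ![w₁] (by intro i; fin_cases i; simpa using hn₂)
    (by intro i j hij; exact absurd (Subsingleton.elim i j) hij) k
  -- the seam: `𝔖₂^canon − 𝔖₁^canon 𝔖₁^canon = c'_k² · l₁ l₂ · T⁰_k(v, w)`
  have hseam :
      latticeSchwinger r.ρ canon (fun s => s.F) k (1 + 1) (fun _ => r.curvature) ![v₁, w₁] -
          latticeSchwinger r.ρ canon (fun s => s.F) k 1 (fun _ => r.curvature) ![v₁] *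
            latticeSchwinger r.ρ canon (fun s => s.F) k 1 (fun _ => r.curvature) ![w₁] =
        canon.c r.curvature k ^ 2 * (l₁ * l₂ * T₂ v w k) := by
    rw [trunc_rescale r canon k v₁ w₁, hv₁, hw₁, trunc_smul]
  have hc : canon.c r.curvature k ^ 2 = (T u k)⁻¹ := by
    show ((Real.sqrt (T u k))⁻¹) ^ 2 = (T u k)⁻¹
    rw [inv_pow, Real.sq_sqrt hTpos.le]
  have hA₁k : 0 ≤ |latticeSchwinger r.ρ canon (fun s => s.F) k 1 (fun _ => r.curvature) ![v₁]| := abs_nonneg _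
  -- |𝔖₂ − 𝔖₁𝔖₁| ≤ A₂ + A₁²
  have hkey : |(T u k)⁻¹ * (l₁ * l₂ * T₂ v w k)| ≤ B₀ := by
    rw [← hc, ← hseam]
    refine (abs_sub _ _).trans (add_le_add (h2.trans (le_abs_self A₂)) ?_)
    rw [abs_mul]
    exact mul_le_mul (h1) (h1') (abs_nonneg _) hA₁0
  rw [abs_mul, abs_mul, abs_of_pos (inv_pos.2 hTpos), abs_of_pos (mul_pos hl₁0 hl₂0)] at hkey
  -- unwind: |T₂ v w k| ≤ B₀ (N₁+1)(N₂+1) · T u k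
  have hll : 0 < l₁ * l₂ := mul_pos hl₁0 hl₂0
  have hprod : (N₁ + 1) * (N₂ + 1) * (l₁ * l₂) = 1 := by
    rw [hl₁, hl₂]; field_simp
  have := mul_le_mul_of_nonneg_left hkey hTpos.le
  -- T u k * (T u k)⁻¹ * (l₁ l₂ |T₂|) = l₁ l₂ |T₂|
  have hstep : l₁ * l₂ * |T₂ v w k| ≤ T u k * B₀ := by
    calc l₁ * l₂ * |T₂ v w k| = T u k * ((T u k)⁻¹ * (l₁ * l₂ * |T₂ v w k|)) := by
          field_simp
      _ ≤ T u k * B₀ := this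
  calc |T₂ v w k| = ((N₁ + 1) * (N₂ + 1)) * (l₁ * l₂ * |T₂ v w k|) := by
        rw [← mul_assoc, hprod, one_mul]
    _ ≤ ((N₁ + 1) * (N₂ + 1)) * (T u k * B₀) :=
        mul_le_mul_of_nonneg_left hstep (mul_nonneg (by linarith) (by linarith))
    _ = B₀ * (N₁ + 1) * (N₂ + 1) * T u k := by ring


/-- **Generic contradiction: an envelope failure along `k`-dependent normalised pairs forbids the moment bounds of
`canon`.**  For ANY scheme and bump with `T⁰_k(u,θu) > 0` eventually: if for every Schwartz order `s` and constant `B`,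
infinitely often in `k` some `|·|ₛ`-normalised disjoint pair `(v, w)` has `B·T⁰_k(u,θu) < |T⁰_k(v,w)|`, then
`UniformMomentBoundsPlanes r canon` fails.  (Used by §A and by every hypothesis-dropped variant of §B.) [folklore] -/
theorem not_uniformMomentBoundsPlanes_of_envelopeFailure
    (r : LatticeRep G) (sch : SpeciesScheme (YMSpecies G)) (u : 𝓢(EuclideanSpace ℝ (Fin 4), ℝ)) :
    let bare : SpeciesScheme (YMSpecies G) := { sch with c := fun _ _ => 1, m := fun _ _ => 0 }
    let T : 𝓢(EuclideanSpace ℝ (Fin 4), ℝ) → ℕ → ℝ := fun w k =>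
      latticeSchwinger r.ρ bare (fun s => s.F) k (1 + 1) (fun _ => r.curvature) ![w, thetaTest 4 w] -
        latticeSchwinger r.ρ bare (fun s => s.F) k 1 (fun _ => r.curvature) ![w] *
          latticeSchwinger r.ρ bare (fun s => s.F) k 1 (fun _ => r.curvature) ![thetaTest 4 w]
    let T₂ : 𝓢(EuclideanSpace ℝ (Fin 4), ℝ) → 𝓢(EuclideanSpace ℝ (Fin 4), ℝ) → ℕ → ℝ := fun v w k =>
      latticeSchwinger r.ρ bare (fun s => s.F) k (1 + 1) (fun _ => r.curvature) ![v, w] -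
        latticeSchwinger r.ρ bare (fun s => s.F) k 1 (fun _ => r.curvature) ![v] *
          latticeSchwinger r.ρ bare (fun s => s.F) k 1 (fun _ => r.curvature) ![w]
    let canon : SpeciesScheme (YMSpecies G) :=
      { sch with
        c := fun _ k => (Real.sqrt (T u k))⁻¹
        m := fun _ k => ∫ U, r.curvature.F (torusLift (sch.side k) U) ∂(wilsonMeasure r.ρ (sch.β k)) }
    (∀ᶠ k in Filter.atTop, 0 < T u k) →
    (∀ (s : ℕ) (B : ℝ), ∃ᶠ k in Filter.atTop, ∃ v w : 𝓢(EuclideanSpace ℝ (Fin 4), ℝ),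
        Disjoint (tsupport v) (tsupport w) ∧ schwartzNorm s (ofRealTest v) ≤ 1 ∧
          schwartzNorm s (ofRealTest w) ≤ 1 ∧ B * T u k < |T₂ v w k|) →
    ¬ UniformMomentBoundsPlanes r canon := by
  intro bare T T₂ canon hT hfail hP
  obtain ⟨s, B, hB0, hB⟩ := twoPointEnvelope_of_uniformMomentBoundsPlanes r sch u hP hT
  obtain ⟨k, ⟨v, w, hdisj, hv, hw', hlt⟩, hTpos, henv⟩ := ((hfail s (4 * B)).and_eventually hB).exists
  have h := henv v w hdisj
  have hle : B * (schwartzNorm s (ofRealTest v) + 1) * (schwartzNorm s (ofRealTest w) + 1) ≤ 4 * B := by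
    have h1 : schwartzNorm s (ofRealTest v) + 1 ≤ 2 := by linarith
    have h2 : schwartzNorm s (ofRealTest w) + 1 ≤ 2 := by linarith
    have h2' : 0 ≤ schwartzNorm s (ofRealTest w) + 1 := by linarith [schwartzNorm_nonneg s (ofRealTest w)]
    calc B * (schwartzNorm s (ofRealTest v) + 1) * (schwartzNorm s (ofRealTest w) + 1)
        ≤ B * 2 * 2 := by
          apply mul_le_mul (mul_le_mul_of_nonneg_left h1 hB0) h2 h2' (by positivity)
      _ = 4 * B := by ring
  have : |_| ≤ 4 * B * _ := h.trans (mul_le_mul_of_nonneg_right hle hTpos.le)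
  exact absurd hlt (not_lt.2 this)

/-- **`H` — an admissible TWO-RATE PAIR** (verbatim the hypothesis of the landed negative lemma; intended inhabitant the
masked product `U(1) × SU(2)`, physics-grade; see the file docblock §A). A HYPOTHESIS. -/
def TwoRatePairScheme : Prop :=
  ∃ (G : Type) (_ : Group G) (_ : TopologicalSpace G) (_ : IsTopologicalGroup G) (_ : CompactSpace G)
    (_ : MeasurableSpace G) (_ : BorelSpace G) (r : LatticeRep G) (sch : SpeciesScheme (YMSpecies G))
    (u v w : 𝓢(EuclideanSpace ℝ (Fin 4), ℝ)) (p : ℕ) (M : ℝ),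
    let bare : SpeciesScheme (YMSpecies G) := { sch with c := fun _ _ => 1, m := fun _ _ => 0 }
    let T : 𝓢(EuclideanSpace ℝ (Fin 4), ℝ) → ℕ → ℝ := fun w k =>
      latticeSchwinger r.ρ bare (fun s => s.F) k (1 + 1) (fun _ => r.curvature) ![w, thetaTest 4 w] -
        latticeSchwinger r.ρ bare (fun s => s.F) k 1 (fun _ => r.curvature) ![w] *
          latticeSchwinger r.ρ bare (fun s => s.F) k 1 (fun _ => r.curvature) ![thetaTest 4 w]
    let T₂ : 𝓢(EuclideanSpace ℝ (Fin 4), ℝ) → 𝓢(EuclideanSpace ℝ (Fin 4), ℝ) → ℕ → ℝ := fun v w k =>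
      latticeSchwinger r.ρ bare (fun s => s.F) k (1 + 1) (fun _ => r.curvature) ![v, w] -
        latticeSchwinger r.ρ bare (fun s => s.F) k 1 (fun _ => r.curvature) ![v] *
          latticeSchwinger r.ρ bare (fun s => s.F) k 1 (fun _ => r.curvature) ![w]
    sch.HasWeakCouplingLimit ∧
    (∃ N : ℕ, 1 ≤ N ∧ ∀ᶠ k in Filter.atTop, (sch.a k)⁻¹ ≤ (sch.a k * (sch.L k : ℝ)) ^ N) ∧
    tsupport u ⊆ {y : EuclideanSpace ℝ (Fin 4) | y 0 < 0} ∧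
    (∀ᶠ k in Filter.atTop, (sch.a k) ^ p ≤ T u k ∧ T u k ≤ M * T (timeShiftTest 4 (-1) u) k) ∧
    Disjoint (tsupport v) (tsupport w) ∧
    ∀ B : ℝ, ∃ᶠ k in Filter.atTop, B * T u k < |T₂ v w k|

/-- The strategist's reflected-pair hypothesis `H_R = TwoRateHonestWindowScheme` (crux workfile
`MaskedSectorObstruction.lean`) is the special case `w := θv` of `TwoRatePairScheme`. [folklore] -/
theorem twoRatePairScheme_of_honest (h : TwoRateHonestWindowScheme) : TwoRatePairScheme := by
  obtain ⟨G, i₁, i₂, i₃, i₄, i₅, i₆, r, sch, u, v, p, M, hw, hpv, hu, hfw, hdisj, hrate⟩ := h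
  exact ⟨G, i₁, i₂, i₃, i₄, i₅, i₆, r, sch, u, v, thetaTest 4 v, p, M, hw, hpv, hu, hfw, hdisj, hrate⟩

/-- An honest two-rate pair datum is in particular a datum of 18929's (past-support-free) `TwoRateWindowScheme` WHEN the
pair is reflected — recorded through the strategist's `twoRateWindowScheme_of_honest`; for a general pair there is no such
inclusion (18929's `H` is typed on reflected pairs), which is why the landed lemma re-proves the envelope for pairs. -/
example (h : TwoRateHonestWindowScheme) : TwoRateWindowScheme :=
  Strategist.twoRateWindowScheme_of_honest h

/-- **`H → ¬U_R`** (landed as `…Negative.SelfNormalisedMomentBoundsR_false_of_TwoRatePairScheme`): at the datum of `H`,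
U_R gives `UniformMomentBoundsPlanes r canon` (by `Iff.rfl`) and the floor gives `T⁰ > 0`; the envelope then bounds
`|T⁰_k(v,w)| ≤ B(|v|ₛ+1)(|w|ₛ+1)T⁰_k(u,θu)` eventually, against the second rate. Class on paper: refuted-MISSTATED, `C′` =
`IsCompactSimpleLieGroup G →` inserted (strategist's U_RS); the masked witness misses `C′`. [folklore] -/
theorem selfNormalisedMomentBoundsR_false_of_twoRatePairScheme :
    TwoRatePairScheme →
      ¬ Summit.QuantumFields.YangMills.Theses.ScalingWindowSplit.SelfNormalisedMomentBoundsR := by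
  rintro ⟨G, _, _, _, _, _, _, r, sch, u, v, w, p, M, hw, hpv, hu, hfw, hdisj, hrate⟩ hU
  obtain ⟨s, B, -, hB⟩ :=
    twoPointEnvelope_of_uniformMomentBoundsPlanes r sch u (hU G r sch u p M hw hpv hu hfw)
      (hfw.mono fun k hk => (pow_pos (sch.a_pos k) p).trans_le hk.1)
  obtain ⟨k, hk₁, hk₂⟩ :=
    ((hrate (B * (schwartzNorm s (ofRealTest v) + 1) * (schwartzNorm s (ofRealTest w) + 1))).and_eventually hB).exists
  exact absurd hk₁ (not_lt.2 (hk₂.2 v w hdisj))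

/-- **Inline `k`-dependent form** (landed as `…Negative.SelfNormalisedMomentBoundsR_false_of_envelopeFailure`): an
admissible datum whose envelope fails for every Schwartz order refutes U_R — shrinking bumps of radius `ε_k` at the
collapsing confinement scale of a masked non-abelian sector are the intended instance. [folklore] -/
theorem selfNormalisedMomentBoundsR_false_of_envelopeFailure
    (r : LatticeRep G) (sch : SpeciesScheme (YMSpecies G)) (u : 𝓢(EuclideanSpace ℝ (Fin 4), ℝ)) (p : ℕ) (M : ℝ) :
    let bare : SpeciesScheme (YMSpecies G) := { sch with c := fun _ _ => 1, m := fun _ _ => 0 }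
    let T : 𝓢(EuclideanSpace ℝ (Fin 4), ℝ) → ℕ → ℝ := fun w k =>
      latticeSchwinger r.ρ bare (fun s => s.F) k (1 + 1) (fun _ => r.curvature) ![w, thetaTest 4 w] -
        latticeSchwinger r.ρ bare (fun s => s.F) k 1 (fun _ => r.curvature) ![w] *
          latticeSchwinger r.ρ bare (fun s => s.F) k 1 (fun _ => r.curvature) ![thetaTest 4 w]
    let T₂ : 𝓢(EuclideanSpace ℝ (Fin 4), ℝ) → 𝓢(EuclideanSpace ℝ (Fin 4), ℝ) → ℕ → ℝ := fun v w k =>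
      latticeSchwinger r.ρ bare (fun s => s.F) k (1 + 1) (fun _ => r.curvature) ![v, w] -
        latticeSchwinger r.ρ bare (fun s => s.F) k 1 (fun _ => r.curvature) ![v] *
          latticeSchwinger r.ρ bare (fun s => s.F) k 1 (fun _ => r.curvature) ![w]
    sch.HasWeakCouplingLimit →
    (∃ N : ℕ, 1 ≤ N ∧ ∀ᶠ k in Filter.atTop, (sch.a k)⁻¹ ≤ (sch.a k * (sch.L k : ℝ)) ^ N) →
    tsupport u ⊆ {y : EuclideanSpace ℝ (Fin 4) | y 0 < 0} →
    (∀ᶠ k in Filter.atTop, (sch.a k) ^ p ≤ T u k ∧ T u k ≤ M * T (timeShiftTest 4 (-1) u) k) →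
    (∀ (s : ℕ) (B : ℝ), ∃ᶠ k in Filter.atTop, ∃ v w : 𝓢(EuclideanSpace ℝ (Fin 4), ℝ),
        Disjoint (tsupport v) (tsupport w) ∧ schwartzNorm s (ofRealTest v) ≤ 1 ∧
          schwartzNorm s (ofRealTest w) ≤ 1 ∧ B * T u k < |T₂ v w k|) →
      ¬ Summit.QuantumFields.YangMills.Theses.ScalingWindowSplit.SelfNormalisedMomentBoundsR := by
  intro bare T T₂ hw hpv hu hfw hfail hU
  exact not_uniformMomentBoundsPlanes_of_envelopeFailure r sch u
    (hfw.mono fun k hk => (pow_pos (sch.a_pos k) p).trans_le hk.1) hfail (hU G r sch u p M hw hpv hu hfw)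

/-! ## §B  Load-bearing hypotheses: the crux with ONE hypothesis dropped -/

/-- U_R WITHOUT the past-support clause — character-identical to the held aside U = `SelfNormalisedMomentBounds`
(stmt-QuantumFields-18929). [folklore] -/
def SelfNormalisedMomentBoundsRWithoutPastSupport : Prop :=
  Summit.QuantumFields.YangMills.Theses.ScalingWindowSplit.SelfNormalisedMomentBounds

/-- Dropping past support gives back U verbatim. [folklore] -/
theorem withoutPastSupport_iff :
    SelfNormalisedMomentBoundsRWithoutPastSupport ↔
      Summit.QuantumFields.YangMills.Theses.ScalingWindowSplit.SelfNormalisedMomentBounds := Iff.rfl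

/-- **Past support is load-bearing (modulo 18929's `H`)**: the landed negative lemma of the aside applies verbatim. [folklore] -/
theorem withoutPastSupport_false_of_twoRateWindowScheme (h : TwoRateWindowScheme) :
    ¬ SelfNormalisedMomentBoundsRWithoutPastSupport :=
  SelfNormalisedMomentBounds_false_of_TwoRateWindowScheme h

/-- **U_R WITHOUT polynomial volumes** (the `∃ N, a_k⁻¹ ≤ (a_kL_k)^N` block dropped; everything else verbatim, conclusion
folded to `UniformMomentBoundsPlanes r canon` by `Iff.rfl`). [folklore] -/
def SelfNormalisedMomentBoundsRWithoutPolyVolume : Prop :=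
  ∀ (G : Type) [Group G] [TopologicalSpace G] [IsTopologicalGroup G] [CompactSpace G] [MeasurableSpace G]
    [BorelSpace G] (r : LatticeRep G) (sch : SpeciesScheme (YMSpecies G)) (u : 𝓢(EuclideanSpace ℝ (Fin 4), ℝ))
    (p : ℕ) (M : ℝ),
    let bare : SpeciesScheme (YMSpecies G) := { sch with c := fun _ _ => 1, m := fun _ _ => 0 }
    let T : 𝓢(EuclideanSpace ℝ (Fin 4), ℝ) → ℕ → ℝ := fun w k =>
      latticeSchwinger r.ρ bare (fun s => s.F) k (1 + 1) (fun _ => r.curvature) ![w, thetaTest 4 w] -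
        latticeSchwinger r.ρ bare (fun s => s.F) k 1 (fun _ => r.curvature) ![w] *
          latticeSchwinger r.ρ bare (fun s => s.F) k 1 (fun _ => r.curvature) ![thetaTest 4 w]
    let canon : SpeciesScheme (YMSpecies G) :=
      { sch with
        c := fun _ k => (Real.sqrt (T u k))⁻¹
        m := fun _ k => ∫ U, r.curvature.F (torusLift (sch.side k) U) ∂(wilsonMeasure r.ρ (sch.β k)) }
    sch.HasWeakCouplingLimit →
    tsupport u ⊆ {y : EuclideanSpace ℝ (Fin 4) | y 0 < 0} →
    (∀ᶠ k in Filter.atTop, (sch.a k) ^ p ≤ T u k ∧ T u k ≤ M * T (timeShiftTest 4 (-1) u) k) →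
    UniformMomentBoundsPlanes r canon

/-- U_R is the polynomial-volume restriction of the variant (sanity: the variant is STRONGER). [folklore] -/
theorem selfNormalisedMomentBoundsR_of_withoutPolyVolume (h : SelfNormalisedMomentBoundsRWithoutPolyVolume) :
    Summit.QuantumFields.YangMills.Theses.ScalingWindowSplit.SelfNormalisedMomentBoundsR := by
  intro G _ _ _ _ _ _ r sch u p M bare T canon hw _hpv hu hfw
  exact h G r sch u p M hw hu hfw

/-- **The torus seam, kinematics: `ℝ⁴`-disjoint is not torus-separated.**  On the scheme's torus of ODD side `2L+1`
(sites `−L … L` per axis, `box 4 L` the fundamental domain) the time-slices `x⁰ = L` and `x⁰ = −L` are NEIGHBOURS: the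
coordinate difference `2L` has minimal residue `−1`.  Two tests supported near `x⁰ = +La` and `x⁰ = −La` are disjoint in
`ℝ⁴` at distance `≈ 2La → ∞`, yet smear plaquettes sharing links. [folklore] -/
theorem seam_adjacent (L : ℕ) (hL : 1 ≤ L) : (((2 * L : ℕ) : ℤ) : ZMod (2 * L + 1)).valMinAbs = -1 := by
  have hcast : (((2 * L : ℕ) : ℤ) : ZMod (2 * L + 1)) = -((1 : ℕ) : ZMod (2 * L + 1)) := by
    have h0 : ((2 * L + 1 : ℕ) : ZMod (2 * L + 1)) = 0 := ZMod.natCast_self _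
    push_cast at h0 ⊢
    linear_combination h0
  have h1 : ((1 : ℕ) : ZMod (2 * L + 1)).valMinAbs = 1 :=
    ZMod.valMinAbs_natCast_of_le_half (by omega)
  have hval : ((1 : ℕ) : ZMod (2 * L + 1)).val = 1 := ZMod.val_cast_of_lt (by omega)
  rw [hcast, ZMod.valMinAbs_neg_of_ne_half (by rw [hval]; omega), h1]

/-- **Polynomial volumes are load-bearing (modulo the seam asymptotics).**  If some datum meets weak coupling, past
support, floor and window (NO volume clause) while its envelope fails for every Schwartz order — intended instance: the
super-weak `U(1)` scheme with SUB-POLYNOMIAL half-sides `L_k` (so `ℓ_k → ∞` slower than every power of `a_k⁻¹`) and the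
seam-hugging pairs of §B, ratio `≍ ℓ_k^{3−2s} a_k⁻³ → ∞` for every `s` — then the volume-free variant is false: any proof
of U_R must use `a_k⁻¹ ≤ (a_kL_k)^N`, and its Schwartz order must depend on `N`. [folklore] -/
theorem withoutPolyVolume_false_of_seamEnvelopeFailure :
    (∃ (G : Type) (_ : Group G) (_ : TopologicalSpace G) (_ : IsTopologicalGroup G) (_ : CompactSpace G)
      (_ : MeasurableSpace G) (_ : BorelSpace G) (r : LatticeRep G) (sch : SpeciesScheme (YMSpecies G))
      (u : 𝓢(EuclideanSpace ℝ (Fin 4), ℝ)) (p : ℕ) (M : ℝ),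
      let bare : SpeciesScheme (YMSpecies G) := { sch with c := fun _ _ => 1, m := fun _ _ => 0 }
      let T : 𝓢(EuclideanSpace ℝ (Fin 4), ℝ) → ℕ → ℝ := fun w k =>
        latticeSchwinger r.ρ bare (fun s => s.F) k (1 + 1) (fun _ => r.curvature) ![w, thetaTest 4 w] -
          latticeSchwinger r.ρ bare (fun s => s.F) k 1 (fun _ => r.curvature) ![w] *
            latticeSchwinger r.ρ bare (fun s => s.F) k 1 (fun _ => r.curvature) ![thetaTest 4 w]
      let T₂ : 𝓢(EuclideanSpace ℝ (Fin 4), ℝ) → 𝓢(EuclideanSpace ℝ (Fin 4), ℝ) → ℕ → ℝ := fun v w k =>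
        latticeSchwinger r.ρ bare (fun s => s.F) k (1 + 1) (fun _ => r.curvature) ![v, w] -
          latticeSchwinger r.ρ bare (fun s => s.F) k 1 (fun _ => r.curvature) ![v] *
            latticeSchwinger r.ρ bare (fun s => s.F) k 1 (fun _ => r.curvature) ![w]
      sch.HasWeakCouplingLimit ∧
      tsupport u ⊆ {y : EuclideanSpace ℝ (Fin 4) | y 0 < 0} ∧
      (∀ᶠ k in Filter.atTop, (sch.a k) ^ p ≤ T u k ∧ T u k ≤ M * T (timeShiftTest 4 (-1) u) k) ∧
      ∀ (s : ℕ) (B : ℝ), ∃ᶠ k in Filter.atTop, ∃ v w : 𝓢(EuclideanSpace ℝ (Fin 4), ℝ),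
        Disjoint (tsupport v) (tsupport w) ∧ schwartzNorm s (ofRealTest v) ≤ 1 ∧
          schwartzNorm s (ofRealTest w) ≤ 1 ∧ B * T u k < |T₂ v w k|) →
      ¬ SelfNormalisedMomentBoundsRWithoutPolyVolume := by
  rintro ⟨G, _, _, _, _, _, _, r, sch, u, p, M, hw, hu, hfw, hfail⟩ hV
  exact not_uniformMomentBoundsPlanes_of_envelopeFailure r sch u
    (hfw.mono fun k hk => (pow_pos (sch.a_pos k) p).trans_le hk.1) hfail (hV G r sch u p M hw hu hfw)

/-- **U_R WITHOUT the window** (floor only: `∀ᶠ k, a_k^p ≤ T⁰_k(u,θu)`; the binder `M` disappears). [folklore] -/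
def SelfNormalisedMomentBoundsRWithoutWindow : Prop :=
  ∀ (G : Type) [Group G] [TopologicalSpace G] [IsTopologicalGroup G] [CompactSpace G] [MeasurableSpace G]
    [BorelSpace G] (r : LatticeRep G) (sch : SpeciesScheme (YMSpecies G)) (u : 𝓢(EuclideanSpace ℝ (Fin 4), ℝ))
    (p : ℕ),
    let bare : SpeciesScheme (YMSpecies G) := { sch with c := fun _ _ => 1, m := fun _ _ => 0 }
    let T : 𝓢(EuclideanSpace ℝ (Fin 4), ℝ) → ℕ → ℝ := fun w k =>
      latticeSchwinger r.ρ bare (fun s => s.F) k (1 + 1) (fun _ => r.curvature) ![w, thetaTest 4 w] -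
        latticeSchwinger r.ρ bare (fun s => s.F) k 1 (fun _ => r.curvature) ![w] *
          latticeSchwinger r.ρ bare (fun s => s.F) k 1 (fun _ => r.curvature) ![thetaTest 4 w]
    let canon : SpeciesScheme (YMSpecies G) :=
      { sch with
        c := fun _ k => (Real.sqrt (T u k))⁻¹
        m := fun _ k => ∫ U, r.curvature.F (torusLift (sch.side k) U) ∂(wilsonMeasure r.ρ (sch.β k)) }
    sch.HasWeakCouplingLimit →
    (∃ N : ℕ, 1 ≤ N ∧ ∀ᶠ k in Filter.atTop, (sch.a k)⁻¹ ≤ (sch.a k * (sch.L k : ℝ)) ^ N) →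
    tsupport u ⊆ {y : EuclideanSpace ℝ (Fin 4) | y 0 < 0} →
    (∀ᶠ k in Filter.atTop, (sch.a k) ^ p ≤ T u k) →
    UniformMomentBoundsPlanes r canon

/-- U_R is the windowed restriction of the variant. [folklore] -/
theorem selfNormalisedMomentBoundsR_of_withoutWindow (h : SelfNormalisedMomentBoundsRWithoutWindow) :
    Summit.QuantumFields.YangMills.Theses.ScalingWindowSplit.SelfNormalisedMomentBoundsR := by
  intro G _ _ _ _ _ _ r sch u p M bare T canon hw hpv hu hfw
  exact h G r sch u p hw hpv hu (hfw.mono fun k hk => hk.1)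

/-- **The window is load-bearing (modulo a slowly collapsing floor datum).**  If some datum meets weak coupling,
polynomial volumes, past support and the FLOOR ONLY while its envelope fails for every order — intended instance: a
confining non-abelian `G` with `m_phys,k = 1/(a_kξ_k) → ∞` but `≤ (p/2d) log a_k⁻¹` (floor kept: `T⁰ ≍ a⁸e^{−2dm}`), on
which a pair at time-distance `δ < 2d` is enhanced by `e^{m(2d−δ)} → ∞` (abelian `G`: massless, no collapse; finite `G`:
frozen, floor fails — so the inhabitant is the weak-coupling mass gap itself, physics-grade) — then the window-free
variant is false: any proof of U_R must use `T⁰(u) ≤ M·T⁰(τ₋₁u)`. [folklore] -/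
theorem withoutWindow_false_of_collapsingEnvelopeFailure :
    (∃ (G : Type) (_ : Group G) (_ : TopologicalSpace G) (_ : IsTopologicalGroup G) (_ : CompactSpace G)
      (_ : MeasurableSpace G) (_ : BorelSpace G) (r : LatticeRep G) (sch : SpeciesScheme (YMSpecies G))
      (u : 𝓢(EuclideanSpace ℝ (Fin 4), ℝ)) (p : ℕ),
      let bare : SpeciesScheme (YMSpecies G) := { sch with c := fun _ _ => 1, m := fun _ _ => 0 }
      let T : 𝓢(EuclideanSpace ℝ (Fin 4), ℝ) → ℕ → ℝ := fun w k =>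
        latticeSchwinger r.ρ bare (fun s => s.F) k (1 + 1) (fun _ => r.curvature) ![w, thetaTest 4 w] -
          latticeSchwinger r.ρ bare (fun s => s.F) k 1 (fun _ => r.curvature) ![w] *
            latticeSchwinger r.ρ bare (fun s => s.F) k 1 (fun _ => r.curvature) ![thetaTest 4 w]
      let T₂ : 𝓢(EuclideanSpace ℝ (Fin 4), ℝ) → 𝓢(EuclideanSpace ℝ (Fin 4), ℝ) → ℕ → ℝ := fun v w k =>
        latticeSchwinger r.ρ bare (fun s => s.F) k (1 + 1) (fun _ => r.curvature) ![v, w] -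
          latticeSchwinger r.ρ bare (fun s => s.F) k 1 (fun _ => r.curvature) ![v] *
            latticeSchwinger r.ρ bare (fun s => s.F) k 1 (fun _ => r.curvature) ![w]
      sch.HasWeakCouplingLimit ∧
      (∃ N : ℕ, 1 ≤ N ∧ ∀ᶠ k in Filter.atTop, (sch.a k)⁻¹ ≤ (sch.a k * (sch.L k : ℝ)) ^ N) ∧
      tsupport u ⊆ {y : EuclideanSpace ℝ (Fin 4) | y 0 < 0} ∧
      (∀ᶠ k in Filter.atTop, (sch.a k) ^ p ≤ T u k) ∧
      ∀ (s : ℕ) (B : ℝ), ∃ᶠ k in Filter.atTop, ∃ v w : 𝓢(EuclideanSpace ℝ (Fin 4), ℝ),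
        Disjoint (tsupport v) (tsupport w) ∧ schwartzNorm s (ofRealTest v) ≤ 1 ∧
          schwartzNorm s (ofRealTest w) ≤ 1 ∧ B * T u k < |T₂ v w k|) →
      ¬ SelfNormalisedMomentBoundsRWithoutWindow := by
  rintro ⟨G, _, _, _, _, _, _, r, sch, u, p, hw, hpv, hu, hfl, hfail⟩ hV
  exact not_uniformMomentBoundsPlanes_of_envelopeFailure r sch u
    (hfl.mono fun k hk => (pow_pos (sch.a_pos k) p).trans_le hk) hfail (hV G r sch u p hw hpv hu hfl)

/-- **The floor is NOT what keeps U_R true — junk-model certificate.**  At a subsingleton gauge group (where U_R itself is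
VACUOUS because the floor fails, `Negative.floor_false_of_subsingleton`) the self-normalised scheme STILL obeys the moment
bounds, for every scheme and bump: `T⁰ ≡ 0`, so `c'_k = (√0)⁻¹ = 0` and every plane field vanishes identically — the
`n`-point integrals are `0^n`.  So dropping the floor re-admits the trivial group without falsifying the conclusion; with
floor AND window dropped nothing in this file breaks either.  The floor's role is `T⁰ > 0` (`c'² = 1/T⁰`, used by every
envelope argument above) and, route-side, `PolyRenorm`. [folklore] -/
theorem canon_bounds_of_subsingleton [Subsingleton G] (r : LatticeRep G) (sch : SpeciesScheme (YMSpecies G))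
    (u : 𝓢(EuclideanSpace ℝ (Fin 4), ℝ)) :
    let bare : SpeciesScheme (YMSpecies G) := { sch with c := fun _ _ => 1, m := fun _ _ => 0 }
    let T : 𝓢(EuclideanSpace ℝ (Fin 4), ℝ) → ℕ → ℝ := fun w k =>
      latticeSchwinger r.ρ bare (fun s => s.F) k (1 + 1) (fun _ => r.curvature) ![w, thetaTest 4 w] -
        latticeSchwinger r.ρ bare (fun s => s.F) k 1 (fun _ => r.curvature) ![w] *
          latticeSchwinger r.ρ bare (fun s => s.F) k 1 (fun _ => r.curvature) ![thetaTest 4 w]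
    let canon : SpeciesScheme (YMSpecies G) :=
      { sch with
        c := fun _ k => (Real.sqrt (T u k))⁻¹
        m := fun _ k => ∫ U, r.curvature.F (torusLift (sch.side k) U) ∂(wilsonMeasure r.ρ (sch.β k)) }
    UniformMomentBoundsPlanes r canon := by
  intro bare T canon
  refine ⟨0, 1, 1, fun n F _ _ k => ?_⟩
  have hT : T u k = 0 := trunc_eq_zero_of_subsingleton r bare k u (thetaTest 4 u)
  have hc : canon.c r.curvature k = 0 := by
    show (Real.sqrt (T u k))⁻¹ = 0
    rw [hT, Real.sqrt_zero, inv_zero]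
  have hf : ∀ (f : Plane → 𝓢(EuclideanSpace ℝ (Fin 4), ℝ)) (U : GaugeConfig 4 (canon.side k) G),
      fieldP r canon k f U = 0 := by
    intro f U
    simp only [fieldP, planeField, hc, smearedLatticeField, zero_mul, Finset.sum_const_zero]
  haveI : IsProbabilityMeasure (wilsonAt r canon k) :=
    isProbabilityMeasure_wilsonMeasure (d := 4) (L := canon.side k) r.ρ r.continuous (canon.β k)
  have hprod : (fun U => ∏ i : Fin n, fieldP r canon k (F i) U) = fun _ => (0 : ℝ) ^ n := by
    funext U
    simp [hf]
  show |∫ U, ∏ i, fieldP r canon k (F i) U ∂(wilsonAt r canon k)| ≤ 1 * 1 ^ n * (n.factorial : ℝ)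
  rw [hprod, integral_const, smul_eq_mul, probReal_univ, one_mul, one_mul, one_pow]
  rcases n with _ | n
  · simp
  · rw [pow_succ, mul_zero, abs_zero]
    positivity

/-! ## §C  Targets — line `Sketch`: the physics stub `stub_clusterBound` -/

/-- **The registered physics stub, verbatim as a `Prop`** (`Lines/Sketch.lean`, skeleton `04989cf1efe3`). [folklore] -/
def ClusterBound : Prop :=
    ∀ (G : Type) [Group G] [TopologicalSpace G] [IsTopologicalGroup G] [CompactSpace G] [MeasurableSpace G]
      [BorelSpace G] (r : LatticeRep G) (sch : SpeciesScheme (YMSpecies G)) (u : 𝓢(EuclideanSpace ℝ (Fin 4), ℝ))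
      (p : ℕ) (M : ℝ),
      let bare : SpeciesScheme (YMSpecies G) := { sch with c := fun _ _ => 1, m := fun _ _ => 0 }
      let T : 𝓢(EuclideanSpace ℝ (Fin 4), ℝ) → ℕ → ℝ := fun w k =>
        latticeSchwinger r.ρ bare (fun s => s.F) k (1 + 1) (fun _ => r.curvature) ![w, thetaTest 4 w] -
          latticeSchwinger r.ρ bare (fun s => s.F) k 1 (fun _ => r.curvature) ![w] *
            latticeSchwinger r.ρ bare (fun s => s.F) k 1 (fun _ => r.curvature) ![thetaTest 4 w]
      let canon : SpeciesScheme (YMSpecies G) :=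
        { sch with
          c := fun _ k => (Real.sqrt (T u k))⁻¹
          m := fun _ k => ∫ U, r.curvature.F (torusLift (sch.side k) U) ∂(wilsonMeasure r.ρ (sch.β k)) }
      sch.HasWeakCouplingLimit →
      (∃ N : ℕ, 1 ≤ N ∧ ∀ᶠ k in atTop, (sch.a k)⁻¹ ≤ (sch.a k * (sch.L k : ℝ)) ^ N) →
      tsupport u ⊆ {y : EuclideanSpace ℝ (Fin 4) | y 0 < 0} →
      (∀ᶠ k in atTop, (sch.a k) ^ p ≤ T u k ∧ T u k ≤ M * T (timeShiftTest 4 (-1) u) k) →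
      ∃ (C : ℝ) (k₀ : ℕ), 1 ≤ C ∧ ∀ k : ℕ, k₀ ≤ k →
        ∀ (n : ℕ) (x : Fin n → Site 4) (q : Fin n → Plane), 2 ≤ n → Function.Injective x →
          (∀ i, x i ∈ box 4 (canon.L k)) →
          |canon.c r.curvature k ^ n *
              ∫ U, ∏ i, ((planeSpecies r (q i)).F (configShift (-(x i)) (torusLift (canon.side k) U)) -
                canon.m r.curvature k / 6) ∂(wilsonAt r canon k)| ≤
            C ^ n * ∑ f : Fin n → Fin n, (if ∀ i, f i ≠ i then
              ∏ i, ((canon.a k * ‖siteToE (fun μ : Fin 4 =>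
                ((((x i μ - x (f i) μ : ℤ) : ZMod (canon.side k)).valMinAbs : ℤ)))‖)⁻¹) ^ 4 else 0)

/-- **The stub at `n = 2`: the SITE-LEVEL two-point envelope.**  For two distinct sites `x 0 ≠ x 1` only the swap is
fixed-point free, so the stub's right side is `C² · (a d(x₀,x₁))⁻⁴ (a d(x₁,x₀))⁻⁴ = C² (a d)⁻⁸`: the centred plaquette
covariance obeys `|Cov_k(P_{q₀}(x₀), P_{q₁}(x₁))| ≤ C² · T⁰_k(u,θu) · (a_k d_torus)⁻⁸` eventually — the pointwise form of
§A's envelope.  The masked product violates it at lattice distance `d = ξ_{SU(2)}(β_k)` by the factor `β_k²`; after `C′`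
(simple `G`) it is the honest ultraviolet `d⁻⁸` law of `tr F²` (lead's `stub_clusterBoundS`).  Here: the literal
instantiation. [folklore] -/
theorem clusterBound_two (h : ClusterBound) :
    ∀ (G : Type) [Group G] [TopologicalSpace G] [IsTopologicalGroup G] [CompactSpace G] [MeasurableSpace G]
      [BorelSpace G] (r : LatticeRep G) (sch : SpeciesScheme (YMSpecies G)) (u : 𝓢(EuclideanSpace ℝ (Fin 4), ℝ))
      (p : ℕ) (M : ℝ),
      let bare : SpeciesScheme (YMSpecies G) := { sch with c := fun _ _ => 1, m := fun _ _ => 0 }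
      let T : 𝓢(EuclideanSpace ℝ (Fin 4), ℝ) → ℕ → ℝ := fun w k =>
        latticeSchwinger r.ρ bare (fun s => s.F) k (1 + 1) (fun _ => r.curvature) ![w, thetaTest 4 w] -
          latticeSchwinger r.ρ bare (fun s => s.F) k 1 (fun _ => r.curvature) ![w] *
            latticeSchwinger r.ρ bare (fun s => s.F) k 1 (fun _ => r.curvature) ![thetaTest 4 w]
      let canon : SpeciesScheme (YMSpecies G) :=
        { sch with
          c := fun _ k => (Real.sqrt (T u k))⁻¹
          m := fun _ k => ∫ U, r.curvature.F (torusLift (sch.side k) U) ∂(wilsonMeasure r.ρ (sch.β k)) }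
      sch.HasWeakCouplingLimit →
      (∃ N : ℕ, 1 ≤ N ∧ ∀ᶠ k in atTop, (sch.a k)⁻¹ ≤ (sch.a k * (sch.L k : ℝ)) ^ N) →
      tsupport u ⊆ {y : EuclideanSpace ℝ (Fin 4) | y 0 < 0} →
      (∀ᶠ k in atTop, (sch.a k) ^ p ≤ T u k ∧ T u k ≤ M * T (timeShiftTest 4 (-1) u) k) →
      ∃ (C : ℝ) (k₀ : ℕ), 1 ≤ C ∧ ∀ k : ℕ, k₀ ≤ k →
        ∀ (x : Fin 2 → Site 4) (q : Fin 2 → Plane), Function.Injective x →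
          (∀ i, x i ∈ box 4 (canon.L k)) →
          |canon.c r.curvature k ^ 2 *
              ∫ U, ∏ i, ((planeSpecies r (q i)).F (configShift (-(x i)) (torusLift (canon.side k) U)) -
                canon.m r.curvature k / 6) ∂(wilsonAt r canon k)| ≤
            C ^ 2 * ∑ f : Fin 2 → Fin 2, (if ∀ i, f i ≠ i then
              ∏ i, ((canon.a k * ‖siteToE (fun μ : Fin 4 =>
                ((((x i μ - x (f i) μ : ℤ) : ZMod (canon.side k)).valMinAbs : ℤ)))‖)⁻¹) ^ 4 else 0) := by
  intro G _ _ _ _ _ _ r sch u p M bare T canon hw hpv hu hfw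
  obtain ⟨C, k₀, hC, hcl⟩ := h G r sch u p M hw hpv hu hfw
  exact ⟨C, k₀, hC, fun k hk x q hx hbox => hcl k hk 2 x q le_rfl hx hbox⟩

/-- **`stub_clusterBound` is false modulo a SITE-LEVEL two-rate datum** (inline hypothesis: an admissible datum at which,
for every `C` and threshold, some pair of distinct box sites violates the `n = 2` instance) — tautological in form, recorded
so the lead's `-- Targets` list carries the verdict: the stub-by-name dies with the crux-by-name (masked product,
physics-grade) and survives `C′`. [folklore] -/
theorem clusterBound_false_of_siteTwoRate
    (hx : ∃ (G : Type) (_ : Group G) (_ : TopologicalSpace G) (_ : IsTopologicalGroup G) (_ : CompactSpace G)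
      (_ : MeasurableSpace G) (_ : BorelSpace G) (r : LatticeRep G) (sch : SpeciesScheme (YMSpecies G))
      (u : 𝓢(EuclideanSpace ℝ (Fin 4), ℝ)) (p : ℕ) (M : ℝ),
      let bare : SpeciesScheme (YMSpecies G) := { sch with c := fun _ _ => 1, m := fun _ _ => 0 }
      let T : 𝓢(EuclideanSpace ℝ (Fin 4), ℝ) → ℕ → ℝ := fun w k =>
        latticeSchwinger r.ρ bare (fun s => s.F) k (1 + 1) (fun _ => r.curvature) ![w, thetaTest 4 w] -
          latticeSchwinger r.ρ bare (fun s => s.F) k 1 (fun _ => r.curvature) ![w] *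
            latticeSchwinger r.ρ bare (fun s => s.F) k 1 (fun _ => r.curvature) ![thetaTest 4 w]
      let canon : SpeciesScheme (YMSpecies G) :=
        { sch with
          c := fun _ k => (Real.sqrt (T u k))⁻¹
          m := fun _ k => ∫ U, r.curvature.F (torusLift (sch.side k) U) ∂(wilsonMeasure r.ρ (sch.β k)) }
      sch.HasWeakCouplingLimit ∧
      (∃ N : ℕ, 1 ≤ N ∧ ∀ᶠ k in atTop, (sch.a k)⁻¹ ≤ (sch.a k * (sch.L k : ℝ)) ^ N) ∧
      tsupport u ⊆ {y : EuclideanSpace ℝ (Fin 4) | y 0 < 0} ∧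
      (∀ᶠ k in atTop, (sch.a k) ^ p ≤ T u k ∧ T u k ≤ M * T (timeShiftTest 4 (-1) u) k) ∧
      ∀ (C : ℝ) (k₀ : ℕ), ∃ k, k₀ ≤ k ∧ ∃ (x : Fin 2 → Site 4) (q : Fin 2 → Plane), Function.Injective x ∧
          (∀ i, x i ∈ box 4 (canon.L k)) ∧
          C ^ 2 * ∑ f : Fin 2 → Fin 2, (if ∀ i, f i ≠ i then
              ∏ i, ((canon.a k * ‖siteToE (fun μ : Fin 4 =>
                ((((x i μ - x (f i) μ : ℤ) : ZMod (canon.side k)).valMinAbs : ℤ)))‖)⁻¹) ^ 4 else 0) <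
          |canon.c r.curvature k ^ 2 *
              ∫ U, ∏ i, ((planeSpecies r (q i)).F (configShift (-(x i)) (torusLift (canon.side k) U)) -
                canon.m r.curvature k / 6) ∂(wilsonAt r canon k)|) :
    ¬ ClusterBound := by
  intro h
  obtain ⟨G, _, _, _, _, _, _, r, sch, u, p, M, hw, hpv, hu, hfw, hviol⟩ := hx
  obtain ⟨C, k₀, -, hcl⟩ := clusterBound_two h G r sch u p M hw hpv hu hfw
  obtain ⟨k, hk, x, q, hinj, hbox, hlt⟩ := hviol C k₀
  exact absurd hlt (not_lt.2 (hcl k hk x q hinj hbox))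

/-- **`stub_clusterBound(S)` is too rigid at LONG distance for an asymptotically free `G` — the corrected shape.**
(Evidence note `stub_clusterBound.md`, stub-misstated.)  Along a DEEP-ULTRAVIOLET admissible scheme of a simple `G`
(`a_k := ξ_lat(β_k)^{-1/3}`, so `ξ_phys,k = ξ_lat^{2/3} → ∞`; `L_k := ⌈a_k⁻³⌉`, torus `ℓ_k = a_k⁻² ≥ ξ_phys,k`, PolyVolume `N = 1`;
floor `p = 9` and window hold — massless-like power laws at the `u`-scale; the route header lists deep-UV schemes as genuine
sub-cases) RG-improved perturbation theory gives `Cov_k(P(x),P(y)) ≍ κ a_k⁸ g_R⁴ R⁻⁸` at physical distance `R = a_k d` with the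
running coupling `g_R = g(μ = 1/R)` INCREASING with `R`; normalised at the `u`-scale, `c'²Cov ≍ (κ/κ')(g_R/g_1)⁴ R⁻⁸`.  Short
distance (`R ≤ 1`) is SOFTER than `R⁻⁸` — fine; but along `R_k = ξ_phys,k^{1−ε_k}`, `ε_k = (log ξ_phys,k)^{-1/2}` (still
perturbative: `g_R² ≍ 1/(2b₀ ε_k log ξ) → 0`) the enhancement is `(g_R/g_1)⁴ = ε_k⁻² = log ξ_phys,k → ∞`: NO `k`-uniform `C`
with the pure kernel `∏ (a d)⁻⁴` exists (physics-grade: two-sided RG asymptotics of lattice `SU(2)` plaquette correlations over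
`1 ≪ R ≪ ξ`, exactly the "asymptotic freedom read on tr F²" the stub appeals to).  The CRUX U_RS is NOT threatened (far bumps
carry Schwartz weights `‖x‖^{-s}`), so the fix is to give each leg a long-distance slack the assembly can pay for with `η`
more Schwartz orders: this `Prop` is the registered stub with `((a d)⁻¹)^4` replaced by `((a d)⁻¹)^4 · (1 + a d)^η`
(`0 < η < 2` keeps the Riemann sums `a⁴ Σ (a d)^{−8+2η}` of `stub_riemannBound` type convergent; `η = 1` covers `log²`).
[folklore] -/
def ClusterBoundSlack (η : ℕ) : Prop :=
    ∀ (G : Type) [Group G] [TopologicalSpace G] [IsTopologicalGroup G] [CompactSpace G] [MeasurableSpace G]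
      [BorelSpace G] (r : LatticeRep G) (sch : SpeciesScheme (YMSpecies G)) (u : 𝓢(EuclideanSpace ℝ (Fin 4), ℝ))
      (p : ℕ) (M : ℝ),
      let bare : SpeciesScheme (YMSpecies G) := { sch with c := fun _ _ => 1, m := fun _ _ => 0 }
      let T : 𝓢(EuclideanSpace ℝ (Fin 4), ℝ) → ℕ → ℝ := fun w k =>
        latticeSchwinger r.ρ bare (fun s => s.F) k (1 + 1) (fun _ => r.curvature) ![w, thetaTest 4 w] -
          latticeSchwinger r.ρ bare (fun s => s.F) k 1 (fun _ => r.curvature) ![w] *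
            latticeSchwinger r.ρ bare (fun s => s.F) k 1 (fun _ => r.curvature) ![thetaTest 4 w]
      let canon : SpeciesScheme (YMSpecies G) :=
        { sch with
          c := fun _ k => (Real.sqrt (T u k))⁻¹
          m := fun _ k => ∫ U, r.curvature.F (torusLift (sch.side k) U) ∂(wilsonMeasure r.ρ (sch.β k)) }
      sch.HasWeakCouplingLimit →
      (∃ N : ℕ, 1 ≤ N ∧ ∀ᶠ k in atTop, (sch.a k)⁻¹ ≤ (sch.a k * (sch.L k : ℝ)) ^ N) →
      tsupport u ⊆ {y : EuclideanSpace ℝ (Fin 4) | y 0 < 0} →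
      (∀ᶠ k in atTop, (sch.a k) ^ p ≤ T u k ∧ T u k ≤ M * T (timeShiftTest 4 (-1) u) k) →
      ∃ (C : ℝ) (k₀ : ℕ), 1 ≤ C ∧ ∀ k : ℕ, k₀ ≤ k →
        ∀ (n : ℕ) (x : Fin n → Site 4) (q : Fin n → Plane), 2 ≤ n → Function.Injective x →
          (∀ i, x i ∈ box 4 (canon.L k)) →
          |canon.c r.curvature k ^ n *
              ∫ U, ∏ i, ((planeSpecies r (q i)).F (configShift (-(x i)) (torusLift (canon.side k) U)) -
                canon.m r.curvature k / 6) ∂(wilsonAt r canon k)| ≤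
            C ^ n * ∑ f : Fin n → Fin n, (if ∀ i, f i ≠ i then
              ∏ i, (((canon.a k * ‖siteToE (fun μ : Fin 4 =>
                ((((x i μ - x (f i) μ : ℤ) : ZMod (canon.side k)).valMinAbs : ℤ)))‖)⁻¹) ^ 4 *
                (1 + canon.a k * ‖siteToE (fun μ : Fin 4 =>
                  ((((x i μ - x (f i) μ : ℤ) : ZMod (canon.side k)).valMinAbs : ℤ)))‖) ^ η) else 0)

/-- The slack form is WEAKER than the registered stub (each leg is multiplied by a factor `≥ 1`), so adopting it costs the
line nothing but a re-run of the assembly with `η` more Schwartz orders. [folklore] -/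
theorem clusterBoundSlack_of_clusterBound (η : ℕ) (h : ClusterBound) : ClusterBoundSlack η := by
  intro G _ _ _ _ _ _ r sch u p M bare T canon hw hpv hu hfw
  obtain ⟨C, k₀, hC, hcl⟩ := h G r sch u p M hw hpv hu hfw
  refine ⟨C, k₀, hC, fun k hk n x q hn hx hbox => (hcl k hk n x q hn hx hbox).trans ?_⟩
  refine mul_le_mul_of_nonneg_left (Finset.sum_le_sum fun f _ => ?_) (pow_nonneg (zero_le_one.trans hC) n)
  split_ifs with hf
  · refine Finset.prod_le_prod (fun i _ => by positivity) fun i _ => ?_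
    refine le_mul_of_one_le_right (by positivity) (one_le_pow₀ ?_)
    have : 0 ≤ canon.a k * ‖siteToE (fun μ : Fin 4 =>
        ((((x i μ - x (f i) μ : ℤ) : ZMod (canon.side k)).valMinAbs : ℤ)))‖ :=
      mul_nonneg (canon.a_pos k).le (norm_nonneg _)
    linarith
  · exact le_rfl

/-! ## §E  Near-miss: the unconditional kill -/

/-- **NEAR-MISS (the only `sorry` of this file): `H` is inhabited.**  With this, `selfNormalisedMomentBoundsR_false_of_twoRatePairScheme`
would be an unconditional `¬U_R`.  Intended witness: `G = U(1) × SU(2)` (compact, NOT simple), `r = e^{iθ} ⊕ V` (faithful,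
`N = 3`), `β_k ↑ ∞` polynomially in `a_k⁻¹`, `a_k := 1/(2 ξ_{SU(2)}(β_k) log β_k)`, `L_k := ⌈a_k⁻²⌉`, `u` a past-supported
bump at time-distance `> 1/2`, `p ≥ 9`, `M` large, `(v, w) = (v, θv)` with `v` a bump at time-distance `d₀ < 1/2`.
OBSTRUCTION: the four admissibility clauses need (P1) two-sided Coulomb-phase asymptotics of Wilson-`U(1)₄` plaquette
correlations along `β_k → ∞` on growing tori (Guth 1980 / Fröhlich–Spencer 1982 give the phase, not these asymptotics in
the tree; the tree's super-weak `U(1)` chain `…SelfNormalisedSkewnessWitness*` controls only `β_k = (k+1)^96`-type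
schemes, where `SU(2)` would be deep-ultraviolet and harmless), and the second rate needs (P2) `ξ_{SU(2)}(β) < ∞`,
`ξ → ∞`, scaling of the plaquette two-point function at distance `ξ` with `β`-independent constants — the weak-coupling
lattice mass gap of `SU(2)₄`.  TRIED INSTEAD (all fail to give a second rate inside an ADMISSIBLE datum): abelian factors
with unequal charges / multiplicities (same `d⁻⁸` shape, constant ratio), finite factors (`e^{−cβ}` at the lattice scale,
below `β⁻²`), a simple factor in its perturbative window (softer than `d⁻⁸` towards the UV), seam pairs (beaten by the
weights under PolyVolume, §B), `k`-dependent shrinking pairs in pure `U(1)` (Gaussian: envelope holds), large `n` at fixed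
`k` (row-sum structure of Wick's theorem matches the stub, §C). -/
theorem twoRatePairScheme_inhabited : TwoRatePairScheme := by
  sorry

end Summit.QuantumFields.YangMills.Cruxes.SelfNormalisedMomentBoundsR.Disproof

end
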